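import Mathlib.FieldTheory.Galois.IsGaloisGroup
import Mathlib.RingTheory.Trace.Basic
import Mathlib.Data.Matrix.Mul
import Mathlib.LinearAlgebra.Matrix.SemiringInverse
import Mathlib.LinearAlgebra.Dimension.Finrank
import HarnessLib

/-!
# Galois descent of label components (`e_τ`-isotypic pieces)

Sources: O. Brinon, B. Conrad, *CMI Summer School notes on p-adic Hodge theory* (2009),
Prop. 6.3.8 (insensitivity of `D_dR` and its filtration to finite base change: Galois descent
`D_{dR,L}(V)^{Gal(L/K)} = D_{dR,K}(V)`); J. Neukirch, *Algebraic Number Theory* (1999), Ch. I §2,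
Prop. (2.6)(ii) and Prop. (2.8) (trace as a sum over embeddings; non-degeneracy of the trace form);
J.-M. Fontaine, *Représentations p-adiques semi-stables*, Astérisque 223 (1994), Exposé III §1.5
(functoriality of `D_B`); S. Patrikis, *Variations on a theorem of Tate*, Mem. AMS 258 (2019),
§2.3.1 (the `τ`-components `e_τ D` of a filtered `F ⊗ E`-module).

We isolate the piece of linear algebra behind "labelled Hodge–Tate weights do not change under
restriction to an open subgroup".  Let `Lt/Kt` be a finite Galois extension with group `Q`
(`IsGaloisGroup Q Kt Lt`), let `G → Q` be a surjection (`φ`), and let `G` act `E`-linearly on an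
`E`-vector space `X` (`ρ`) together with a ring action `μ : Lt → End_E X` which is
`φ`-semilinear (`ρ g ∘ μ l = μ (φ g • l) ∘ ρ g`), both preserving a subspace `Fil`.  For a ring
homomorphism `τ : Lt → E` ("label") we compare

* `S₁ = {x ∈ Fil | x is fixed by ker φ, and μ l x = τ l • x for all l ∈ Lt}` (the `τ`-component
  over the big field `Lt` of the invariants of the small group `ker φ`), and
* `S₂ = {x ∈ Fil | x is fixed by G, and μ k x = τ k • x for all k ∈ Kt}` (the `τ|Kt`-component
  over the small field of the invariants of the big group).

**Theorem** (`nonempty_linearEquiv_of_isGaloisGroup`): `S₁ ≃ₗ[E] S₂`; in particular they have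
the same `E`-dimension (`finrank_eq_of_isGaloisGroup`).  The maps are the orbit sum
`x ↦ ∑_{q ∈ Q} ρ(s q) x` (`s` a set-theoretic section of `φ`) and the "`τ`-projector"
`y ↦ ∑ᵢ τ(bᵢ^∨) • μ(bᵢ) y` for a `Kt`-basis `bᵢ` of `Lt` with trace-dual basis `bᵢ^∨`; that they
are mutually inverse is the pair of identities `∑_q q • l = Tr(l)` and
`∑ᵢ bᵢ^∨ · q(bᵢ) = δ_{q,1}` (non-degeneracy of the trace form), i.e. the normal basis /
independence-of-characters computation underlying Brinon–Conrad's proof of Prop. 6.3.8.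
Applied in `Literature.NumberTheory.PAdicHodge.LabelledHodgeTateWeightsBaseChangeProofs` to
`X = M ⊗ B_dR`, it gives `HT_{τ''}(ρ|_{Γ_L}) = HT_{τ''|_K}(ρ)`.
-/

namespace Literature.NumberTheory.GaloisRepresentations

open Module

universe u

section LabelGaloisDescent

variable {Kt Lt : Type*} [Field Kt] [Field Lt] [Algebra Kt Lt]
  {Q : Type*} [Group Q] [MulSemiringAction Q Lt]

/-- **`Tr_{Lt/Kt}(l) = ∑_{q ∈ Q} q • l`** for a Galois group `Q` of `Lt/Kt`
(Mathlib's `trace_eq_sum_automorphisms`, reindexed by `Q ≃ Gal(Lt/Kt)`); Neukirch, *Algebraic Number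
Theory*, Ch. I, Prop. (2.6)(ii). [cite: NeukirchANT1999, Ch. I Prop. 2.6(ii)] -/
theorem algebraMap_trace_eq_sum_smul [Fintype Q] [IsGaloisGroup Q Kt Lt] (l : Lt) :
    algebraMap Kt Lt (Algebra.trace Kt Lt l) = ∑ q : Q, q • l := by
  haveI : IsGalois Kt Lt := IsGaloisGroup.isGalois Q Kt Lt
  haveI : FiniteDimensional Kt Lt := IsGaloisGroup.finiteDimensional Q Kt Lt
  rw [trace_eq_sum_automorphisms]
  refine (Fintype.sum_equiv (IsGaloisGroup.mulEquivAlgEquiv Q Kt Lt).toEquiv _ _ fun q => ?_).symm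
  simp

/-- **Dual-basis orthogonality across the Galois group**: for a `Kt`-basis `b` of `Lt` with
trace-dual basis `b^∨`, `∑ᵢ bᵢ^∨ · (q • bᵢ) = δ_{q,1}`.  (The matrix `(q • bᵢ^∨)_{i,q}` is a left
inverse of `(q • bⱼ)_{q,j}` by `Tr(bᵢ^∨ bⱼ) = δ_{ij}` and `Tr = ∑_q q`; both are square of size
`[Lt : Kt] = #Q`, so it is also a right inverse.)  This is the matrix identity
`(Tr(αᵢαⱼ)) = (σₖαᵢ)ᵗ(σₖαⱼ)` of Neukirch, Ch. I §2 (before (2.7)), combined with the non-degeneracy of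
the trace form, Prop. (2.8). [cite: NeukirchANT1999, Ch. I §2 Prop. 2.8 (and the identity preceding (2.7))] -/
theorem sum_traceDual_mul_smul [Fintype Q] [DecidableEq Q] [IsGaloisGroup Q Kt Lt]
    {ι : Type*} [Fintype ι] [DecidableEq ι] [FiniteDimensional Kt Lt] [Algebra.IsSeparable Kt Lt]
    (b : Basis ι Kt Lt) (q : Q) :
    ∑ i, b.traceDual i * (q • b i) = if q = 1 then 1 else 0 := by
  -- the two matrices
  set A : Matrix Q ι Lt := Matrix.of fun q j => q • b j with hA
  set B : Matrix ι Q Lt := Matrix.of fun i q => q • b.traceDual i with hB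
  have hBA : B * A = 1 := by
    ext i j
    simp only [Matrix.mul_apply, hA, hB, Matrix.of_apply, Matrix.one_apply]
    calc ∑ q : Q, q • b.traceDual i * q • b j
        = ∑ q : Q, q • (b.traceDual i * b j) := by simp only [smul_mul']
      _ = algebraMap Kt Lt (Algebra.trace Kt Lt (b.traceDual i * b j)) :=
          (algebraMap_trace_eq_sum_smul (Q := Q) _).symm
      _ = if i = j then 1 else 0 := by
          rw [Module.Basis.trace_traceDual_mul]
          by_cases h : i = j
          · subst h; simp
          · simp [h, Ne.symm h]
  have hcard : Fintype.card Q = Fintype.card ι := by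
    rw [← Nat.card_eq_fintype_card, IsGaloisGroup.card_eq_finrank Q Kt Lt,
      Module.finrank_eq_card_basis b]
  have hAB : A * B = 1 := (Matrix.mul_eq_one_comm_of_equiv (Fintype.equivOfCardEq hcard)).mpr hBA
  have h := congr_fun (congr_fun hAB q) 1
  simp only [Matrix.mul_apply, hA, hB, Matrix.of_apply, one_smul, Matrix.one_apply] at h
  rw [← h]
  exact Finset.sum_congr rfl fun i _ => mul_comm _ _

variable {E : Type*} [Field E] {X : Type*} [AddCommGroup X] [Module E X] {G : Type*} [Group G]

/-- **Galois descent of label components.**  With the notation of the module docstring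
(`Q` a finite Galois group of `Lt/Kt`, `φ : G → Q` surjective, `ρ : G → End_E X`,
`μ : Lt → End_E X` `φ`-semilinear with respect to `ρ`, `τ : Lt → E`, `Fil ⊆ X` stable under `ρ`
and `μ`), the `τ`-component of the `ker φ`-invariants of `Fil` over `Lt` is `E`-isomorphic to the
`τ|Kt`-component of the `G`-invariants over `Kt`.  The submodules are supplied through their
membership conditions `hS₁`, `hS₂`.  Brinon–Conrad, Prop. 6.3.8 (Galois descent
`(L ⊗_K D_K)^{Gal(L/K)}`-style identification `D_{dR,L}(V) = L ⊗_K D_{dR,K}(V)`, componentwise).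
[cite: BrinonConrad2009, Prop. 6.3.8] -/
theorem nonempty_linearEquiv_of_isGaloisGroup [Finite Q] [IsGaloisGroup Q Kt Lt]
    (φ : G →* Q) (hφ : Function.Surjective φ)
    (ρ : G →* Module.End E X) (μ : Lt →+* Module.End E X)
    (hρμ : ∀ (g : G) (l : Lt) (x : X), ρ g (μ l x) = μ (φ g • l) (ρ g x))
    (τ : Lt →+* E) (Fil : Submodule E X)
    (hFρ : ∀ (g : G) (x : X), x ∈ Fil → ρ g x ∈ Fil)
    (hFμ : ∀ (l : Lt) (x : X), x ∈ Fil → μ l x ∈ Fil)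
    (S₁ S₂ : Submodule E X)
    (hS₁ : ∀ x, x ∈ S₁ ↔ x ∈ Fil ∧ (∀ g, φ g = 1 → ρ g x = x) ∧ ∀ l, μ l x = τ l • x)
    (hS₂ : ∀ x, x ∈ S₂ ↔ x ∈ Fil ∧ (∀ g, ρ g x = x) ∧
      ∀ k : Kt, μ (algebraMap Kt Lt k) x = τ (algebraMap Kt Lt k) • x) :
    Nonempty (S₁ ≃ₗ[E] S₂) := by
  classical
  cases nonempty_fintype Q
  haveI : IsGalois Kt Lt := IsGaloisGroup.isGalois Q Kt Lt
  haveI : FiniteDimensional Kt Lt := IsGaloisGroup.finiteDimensional Q Kt Lt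
  -- a set-theoretic section of `φ`
  obtain ⟨s, hs⟩ : ∃ s : Q → G, ∀ q, φ (s q) = q :=
    ⟨Function.surjInv hφ, Function.surjInv_eq hφ⟩
  -- a basis and its trace dual
  set b : Basis (Fin (finrank Kt Lt)) Kt Lt := Module.finBasis Kt Lt
  set bd : Basis (Fin (finrank Kt Lt)) Kt Lt := b.traceDual with hbd
  -- the three identities in `Lt`
  have F1 : ∀ l : Lt, algebraMap Kt Lt (Algebra.trace Kt Lt l) = ∑ q : Q, q • l :=
    fun l => algebraMap_trace_eq_sum_smul (Q := Q) l
  have F2 : ∀ x : Lt, ∑ i, Algebra.trace Kt Lt (x * b i) • bd i = x := fun x => by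
    conv_rhs => rw [← bd.sum_repr x]
    refine Finset.sum_congr rfl fun i _ => ?_
    rw [hbd, Module.Basis.traceDual_repr_apply, Algebra.traceForm_apply]
  have F3 : ∀ q : Q, ∑ i, bd i * (q • b i) = if q = 1 then 1 else 0 :=
    fun q => sum_traceDual_mul_smul (Q := Q) b q
  -- (E1): `l · b_k^∨ = ∑ᵢ [l bᵢ]_k • bᵢ^∨` (transpose rule for the dual basis)
  have E1 : ∀ (l : Lt) (k : Fin (finrank Kt Lt)),
      l * bd k = ∑ i, b.repr (l * b i) k • bd i := fun l k => by
    rw [← F2 (l * bd k)]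
    refine Finset.sum_congr rfl fun i _ => ?_
    congr 1
    have : l * bd k * b i = bd k * (l * b i) := by ring
    rw [this]
    conv_lhs => rw [← b.sum_repr (l * b i)]
    rw [Finset.mul_sum, map_sum]
    simp_rw [mul_smul_comm, map_smul, hbd, Module.Basis.trace_traceDual_mul, smul_eq_mul, mul_ite,
      mul_one, mul_zero, Finset.sum_ite_eq', Finset.mem_univ, if_true]
  -- commutation rule in the other direction
  have hμρ : ∀ (g : G) (l : Lt) (x : X), μ l (ρ g x) = ρ g (μ ((φ g)⁻¹ • l) x) :=
    fun g l x => by rw [hρμ, smul_inv_smul]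
  -- `Q` fixes `Kt`
  have hqK : ∀ (q : Q) (k : Kt), q • algebraMap Kt Lt k = algebraMap Kt Lt k :=
    fun q k => smul_algebraMap q k
  -- the two maps
  let αf : Module.End E X := ∑ q : Q, ρ (s q)
  let βf : Module.End E X := ∑ i, τ (bd i) • μ (b i)
  have hαf : ∀ x, αf x = ∑ q : Q, ρ (s q) x := fun x => by
    simp only [αf, LinearMap.coe_sum, Finset.sum_apply]
  have hβf : ∀ y, βf y = ∑ i, τ (bd i) • μ (b i) y := fun y => by
    simp only [βf, LinearMap.coe_sum, Finset.sum_apply, LinearMap.smul_apply]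
  -- inner expansion: on `S₂`, `μ z y = ∑_k τ([z]_k) • μ(b_k) y`
  have IE : ∀ y, y ∈ S₂ → ∀ z : Lt,
      μ z y = ∑ k, τ (algebraMap Kt Lt (b.repr z k)) • μ (b k) y := by
    intro y hy z
    obtain ⟨-, -, hyeig⟩ := (hS₂ y).1 hy
    conv_lhs => rw [← b.sum_repr z]
    rw [map_sum, LinearMap.coe_sum, Finset.sum_apply]
    refine Finset.sum_congr rfl fun k _ => ?_
    rw [Algebra.smul_def, mul_comm, map_mul, Module.End.mul_apply, hyeig, map_smul]
  -- `α` maps `S₁` into `S₂`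
  have hα : ∀ x, x ∈ S₁ → αf x ∈ S₂ := by
    intro x hx
    obtain ⟨hxF, hxker, hxeig⟩ := (hS₁ x).1 hx
    rw [hS₂, hαf]
    refine ⟨Submodule.sum_mem _ fun q _ => hFρ _ _ hxF, fun g => ?_, fun k => ?_⟩
    · rw [map_sum]
      have key : ∀ q, ρ g (ρ (s q) x) = ρ (s (φ g * q)) x := fun q => by
        have hn : φ ((s (φ g * q))⁻¹ * (g * s q)) = 1 := by
          rw [map_mul, map_inv, map_mul, hs, hs, inv_mul_cancel]
        calc ρ g (ρ (s q) x) = ρ (g * s q) x := by rw [map_mul, Module.End.mul_apply]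
          _ = ρ (s (φ g * q) * ((s (φ g * q))⁻¹ * (g * s q))) x := by rw [mul_inv_cancel_left]
          _ = ρ (s (φ g * q)) (ρ ((s (φ g * q))⁻¹ * (g * s q)) x) := by
              rw [map_mul, Module.End.mul_apply]
          _ = ρ (s (φ g * q)) x := by rw [hxker _ hn]
      simp_rw [key]
      exact Fintype.sum_equiv (Equiv.mulLeft (φ g)) _ _ fun q => rfl
    · rw [map_sum, Finset.smul_sum]
      refine Finset.sum_congr rfl fun q _ => ?_
      rw [hμρ, hqK, hxeig, map_smul]
  -- `β` maps `S₂` into `S₁`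
  have hβ : ∀ y, y ∈ S₂ → βf y ∈ S₁ := by
    intro y hy
    obtain ⟨hyF, hyinv, hyeig⟩ := (hS₂ y).1 hy
    rw [hS₁, hβf]
    refine ⟨Submodule.sum_mem _ fun i _ => Submodule.smul_mem _ _ (hFμ _ _ hyF), fun g hg => ?_,
      fun l => ?_⟩
    · rw [map_sum]
      refine Finset.sum_congr rfl fun i _ => ?_
      rw [map_smul, hρμ, hg, one_smul, hyinv]
    · -- `μ l (β y) = τ l • β y`
      rw [map_sum, Finset.smul_sum]
      calc ∑ i, μ l (τ (bd i) • μ (b i) y)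
          = ∑ i, τ (bd i) • ∑ k, τ (algebraMap Kt Lt (b.repr (l * b i) k)) • μ (b k) y := by
            refine Finset.sum_congr rfl fun i _ => ?_
            rw [map_smul, ← Module.End.mul_apply, ← map_mul, IE y hy]
        _ = ∑ k, (∑ i, τ (bd i) * τ (algebraMap Kt Lt (b.repr (l * b i) k))) • μ (b k) y := by
            simp_rw [Finset.smul_sum, smul_smul, Finset.sum_smul]
            exact Finset.sum_comm
        _ = ∑ k, τ (l * bd k) • μ (b k) y := by
            refine Finset.sum_congr rfl fun k _ => ?_
            congr 1
            rw [E1 l k, map_sum]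
            refine Finset.sum_congr rfl fun i _ => ?_
            rw [Algebra.smul_def, RingHom.map_mul, mul_comm]
        _ = ∑ k, τ l • τ (bd k) • μ (b k) y := by
            refine Finset.sum_congr rfl fun k _ => ?_
            rw [map_mul, mul_smul]
  -- `β ∘ α = id` on `S₁`
  have hβα : ∀ x, x ∈ S₁ → βf (αf x) = x := by
    intro x hx
    obtain ⟨hxF, hxker, hxeig⟩ := (hS₁ x).1 hx
    rw [hβf]
    calc ∑ i, τ (bd i) • μ (b i) (αf x)
        = ∑ i, τ (bd i) • ∑ q : Q, τ (q⁻¹ • b i) • ρ (s q) x := by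
          refine Finset.sum_congr rfl fun i _ => ?_
          rw [hαf, map_sum]
          congr 1
          refine Finset.sum_congr rfl fun q _ => ?_
          rw [hμρ, hs, hxeig, map_smul]
      _ = ∑ q : Q, τ (∑ i, bd i * (q⁻¹ • b i)) • ρ (s q) x := by
          simp_rw [Finset.smul_sum, smul_smul, map_sum, map_mul, Finset.sum_smul]
          exact Finset.sum_comm
      _ = ∑ q : Q, (if q = 1 then (1 : E) else 0) • ρ (s q) x := by
          refine Finset.sum_congr rfl fun q _ => ?_
          rw [F3, inv_eq_one]
          split_ifs <;> simp
      _ = x := by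
          simp only [ite_smul, one_smul, zero_smul, Finset.sum_ite_eq', Finset.mem_univ, if_true]
          exact hxker _ (hs 1)
  -- `α ∘ β = id` on `S₂`
  have hαβ : ∀ y, y ∈ S₂ → αf (βf y) = y := by
    intro y hy
    obtain ⟨hyF, hyinv, hyeig⟩ := (hS₂ y).1 hy
    rw [hαf]
    calc ∑ q : Q, ρ (s q) (βf y)
        = ∑ q : Q, ∑ i, τ (bd i) • μ (q • b i) y := by
          refine Finset.sum_congr rfl fun q _ => ?_
          rw [hβf, map_sum]
          refine Finset.sum_congr rfl fun i _ => ?_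
          rw [map_smul, hρμ, hs, hyinv]
      _ = ∑ i, τ (bd i) • μ (∑ q : Q, q • b i) y := by
          rw [Finset.sum_comm]
          refine Finset.sum_congr rfl fun i _ => ?_
          rw [← Finset.smul_sum, map_sum, LinearMap.coe_sum, Finset.sum_apply]
      _ = ∑ i, (τ (algebraMap Kt Lt (Algebra.trace Kt Lt (b i))) * τ (bd i)) • y := by
          refine Finset.sum_congr rfl fun i _ => ?_
          rw [← F1, hyeig, smul_smul, mul_comm]
      _ = τ (∑ i, Algebra.trace Kt Lt (1 * b i) • bd i) • y := by
          rw [map_sum, Finset.sum_smul]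
          refine Finset.sum_congr rfl fun i _ => ?_
          rw [one_mul, Algebra.smul_def, map_mul]
      _ = y := by rw [F2, map_one, one_smul]
  -- assemble the linear equivalence
  refine ⟨LinearEquiv.ofLinear (αf.restrict fun x hx => hα x hx) (βf.restrict fun y hy => hβ y hy)
    ?_ ?_⟩
  · ext ⟨y, hy⟩
    simp only [LinearMap.coe_comp, Function.comp_apply, LinearMap.coe_restrict_apply,
      LinearMap.id_coe, id_eq]
    exact hαβ y hy
  · ext ⟨x, hx⟩
    simp only [LinearMap.coe_comp, Function.comp_apply, LinearMap.coe_restrict_apply,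
      LinearMap.id_coe, id_eq]
    exact hβα x hx

/-- **Galois descent of label components, dimension form**: `dim_E S₁ = dim_E S₂` in the
situation of `nonempty_linearEquiv_of_isGaloisGroup`.  This is the equality
`dim_E Fil^i D_{τ''}(ρ|_{open subgroup}) = dim_E Fil^i D_{τ''|K}(ρ)` behind Brinon–Conrad
Prop. 6.3.8 / Patrikis §2.7.1. [cite: BrinonConrad2009, Prop. 6.3.8] -/
theorem finrank_eq_of_isGaloisGroup [Finite Q] [IsGaloisGroup Q Kt Lt]
    (φ : G →* Q) (hφ : Function.Surjective φ)
    (ρ : G →* Module.End E X) (μ : Lt →+* Module.End E X)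
    (hρμ : ∀ (g : G) (l : Lt) (x : X), ρ g (μ l x) = μ (φ g • l) (ρ g x))
    (τ : Lt →+* E) (Fil : Submodule E X)
    (hFρ : ∀ (g : G) (x : X), x ∈ Fil → ρ g x ∈ Fil)
    (hFμ : ∀ (l : Lt) (x : X), x ∈ Fil → μ l x ∈ Fil)
    (S₁ S₂ : Submodule E X)
    (hS₁ : ∀ x, x ∈ S₁ ↔ x ∈ Fil ∧ (∀ g, φ g = 1 → ρ g x = x) ∧ ∀ l, μ l x = τ l • x)
    (hS₂ : ∀ x, x ∈ S₂ ↔ x ∈ Fil ∧ (∀ g, ρ g x = x) ∧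
      ∀ k : Kt, μ (algebraMap Kt Lt k) x = τ (algebraMap Kt Lt k) • x) :
    Module.finrank E S₁ = Module.finrank E S₂ := by
  obtain ⟨e⟩ := nonempty_linearEquiv_of_isGaloisGroup φ hφ ρ μ hρμ τ Fil hFρ hFμ S₁ S₂ hS₁ hS₂
  exact e.finrank_eq

end LabelGaloisDescent

end Literature.NumberTheory.GaloisRepresentations
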